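import Summits.Ventures.HSemireg.WedgeHankelRecurrenceGaussJacobiZeros

/-!
# Venture HSemireg — **SCHUR'S RESULTANT THEOREM FOR A THREE-TERM RECURRENCE**: over ANY commutative ring, for `q_0 = 1`, `q_1 = X − a_0`,
# `q_{n+2} = (X − a_{n+1}) q_{n+1} − b_{n+1} q_n` one has **`Res(q_{n+1}, q_n) = ∏_{k=1}^{n} (−b_k)^k = (−1)^{n(n+1)∕2} ∏_{k=1}^{n} b_k^k`** (Mathlib's
# `Polynomial.resultant` at the formal degrees `(n+1, n)`); at the zeros `x_0, …, x_t` of `q_{t+1} = ∏ (X − x_k)` (any field) this reads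
# **`∏_k q_t(x_k) = (−1)^{t(t+1)∕2} ∏_{j=1}^{t} b_j^j`** and `∏_k q_{t+2}(x_k) = (−b_{t+1})^{t+1} ∏_k q_t(x_k)`

HONEST FRAMING. Part of the Lean index of the computation cell `pub-hsemireg` (seat p10 gen 47, Sunday typer «UNIFORM-IN-n»).  Polynomial algebra over a commutative ring ∕ a field only
(Mathlib `Polynomial.resultant`); no variety, no cohomology theory, no sheaf, no Ext group and no semiregularity map is constructed here; nothing here says that HC / HC_CM / HC_AV holds;
no Literature fact (unproved `Prop`) is declared or used.  Custodian versions as in `WedgeHankelSiegelIdeal` (1/3).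
SOURCES (cited).  I. Schur, *Affektlose Gleichungen in der Theorie der Laguerreschen und Hermiteschen Polynome*, J. reine angew. Math. 165 (1931) 52–58, §1 (the resultant of
consecutive terms of a three-term recurrence, `Res = ∏ (−b_k)^k`, and `∏ q_{n−1}(x_ν)`); G. Szegő, *Orthogonal Polynomials*, §6.71 (Schur's method for discriminants, eq. (6.71.2));
M. E. H. Ismail, *Classical and Quantum Orthogonal Polynomials* (2005), §3.4 «discriminants», Lemma 3.4.1 ∕ Thm 3.4.2 (the same computation for general orthogonal polynomials).
PROOF TYPED HERE.  `q_{n+2} = (−b_{n+1}) q_n + q_{n+1}·(X − a_{n+1})`, so `Res_{(n+2,n+1)}(q_{n+2}, q_{n+1}) = Res_{(n+2,n+1)}(−b_{n+1} q_n, q_{n+1})` (Mathlib `resultant_add_mul_left`); two formal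
degrees are dropped with `resultant_add_left_deg` (`[X^{n+1}] q_{n+1} = 1`), the scalar comes out by `resultant_C_mul_left`, and `resultant_comm` has the even sign `(−1)^{n(n+1)}`; induction
from `Res_{(1,0)}(q_1, 1) = 1`.  The zero form is `resultant_prod_left` + `resultant_X_sub_C_left`.  Degrees: only `deg q_n ≤ n`, `[X^n] q_n = 1` are needed (no nontriviality).
DEDUP DISCLOSURE (`rg -n -i 'schur_resultant|resultant \(q|prod_eval_pred' Summits/Ventures/HSemireg Literature`, 2026-09-04): the lineage's resultant leaves (N94 `det_mulResidueMat_eq_resultant`,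
N151 `det_bezoutian_eq_sign_mul_resultant_of_monic`, N161 `sign_resultant_eq`) concern Hankel ∕ Bezoutian determinants and signs, not the recurrence product formula; 0 hits for the 8 names below.

WHAT IS IN THE TREE.  Mathlib `Polynomial.resultant_add_mul_left`, `resultant_add_left_deg`, `resultant_C_mul_left`, `resultant_comm`, `resultant_one_right`, `resultant_prod_left`,
`resultant_X_sub_C_left`, `natDegree_finsetProd_X_sub_C_eq_card`; N247 `recurrence_monic_natDegree` (the `ℝ` case of the degree lemma, not used: a ring-general version is typed here).
THIS FILE (namespace `Summit.Ventures.HSemireg.Wedge.HankelOuter` continued; CHAINED on N402 (import only); 0 definitions):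
* §1168 `recurrence_natDegree_le_coeff` (any commutative ring: `deg q_n ≤ n`, `[X^n] q_n = 1`), `schur_resultant_succ` (`Res(q_{n+2}, q_{n+1}) = (−b_{n+1})^{n+1} Res(q_{n+1}, q_n)`),
  **`schur_resultant`** (`Res_{(n+1,n)}(q_{n+1}, q_n) = ∏_{k<n} (−b_{k+1})^{k+1}`), `prod_neg_pow_succ_eq` (`∏_{k<n} (−b_{k+1})^{k+1} = (−1)^{n(n+1)∕2} ∏ b_{k+1}^{k+1}`), **`schur_resultant_sign`**,
  `schur_resultant_swap` (`Res_{(n,n+1)}(q_n, q_{n+1})`, same value), **`prod_eval_pred_at_zeros`** (`∏_k q_t(x_k) = (−1)^{t(t+1)∕2} ∏ b_j^j` when `q_{t+1} = ∏ (X − x_k)`, any field),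
  `prod_eval_succ_at_zeros` (`∏_k q_{t+2}(x_k) = (−b_{t+1})^{t+1} ∏_k q_t(x_k)`).
CAVEATS.  Formal degrees are explicit arguments of `Polynomial.resultant` throughout; no positivity of `b` and no ordering of the zeros is assumed in this file.  Nothing Ext-side.  New names only.
-/

open Module Polynomial
open scoped Matrix Polynomial

namespace Summit.Ventures.HSemireg.Wedge.HankelOuter

/-! ## §1168. Schur's resultant theorem -/

/-- Over ANY commutative ring: **`deg q_n ≤ n` and `[X^n] q_n = 1`** for the three-term recurrence (no nontriviality needed). [Schur 1931 §1; this file, §1168] -/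
theorem recurrence_natDegree_le_coeff {R : Type*} [CommRing R] {q : ℕ → R[X]} {a b : ℕ → R} (hq0 : q 0 = 1) (hq1 : q 1 = Polynomial.X - C (a 0))
    (hrec : ∀ n, q (n + 2) = (Polynomial.X - C (a (n + 1))) * q (n + 1) - C (b (n + 1)) * q n) (n : ℕ) :
    (q n).natDegree ≤ n ∧ (q n).coeff n = 1 := by
  have key : ∀ n, ((q n).natDegree ≤ n ∧ (q n).coeff n = 1) ∧ ((q (n + 1)).natDegree ≤ n + 1 ∧ (q (n + 1)).coeff (n + 1) = 1) := by
    intro n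
    induction n with
    | zero =>
      refine ⟨⟨by rw [hq0, natDegree_one], by rw [hq0, coeff_one_zero]⟩, ?_, ?_⟩
      · rw [hq1]; exact natDegree_X_sub_C_le _
      · rw [hq1]; simp
    | succ n ih =>
      obtain ⟨⟨h0d, -⟩, h1d, h1c⟩ := ih
      refine ⟨⟨h1d, h1c⟩, ?_, ?_⟩
      · rw [show n + 1 + 1 = n + 2 from rfl, hrec n]
        refine (natDegree_sub_le _ _).trans (max_le ?_ ?_)
        · exact natDegree_mul_le.trans (by have := natDegree_X_sub_C_le (a (n + 1)); omega)
        · exact (natDegree_C_mul_le _ _).trans (by omega)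
      · rw [show n + 1 + 1 = n + 2 from rfl, hrec n, coeff_sub, sub_mul, coeff_sub, coeff_X_mul, h1c, coeff_C_mul, coeff_C_mul,
          coeff_eq_zero_of_natDegree_lt (by omega : (q (n + 1)).natDegree < n + 2), coeff_eq_zero_of_natDegree_lt (by omega : (q n).natDegree < n + 2)]
        ring
  exact (key n).1

/-- **SCHUR'S STEP: `Res_{(n+2,n+1)}(q_{n+2}, q_{n+1}) = (−b_{n+1})^{n+1} · Res_{(n+1,n)}(q_{n+1}, q_n)`** (any commutative ring). [Schur 1931 §1; Szegő (6.71.2); this file, §1168] -/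
theorem schur_resultant_succ {R : Type*} [CommRing R] {q : ℕ → R[X]} {a b : ℕ → R} (hq0 : q 0 = 1) (hq1 : q 1 = Polynomial.X - C (a 0))
    (hrec : ∀ n, q (n + 2) = (Polynomial.X - C (a (n + 1))) * q (n + 1) - C (b (n + 1)) * q n) (n : ℕ) :
    (q (n + 2)).resultant (q (n + 1)) (n + 2) (n + 1) = (-b (n + 1)) ^ (n + 1) * (q (n + 1)).resultant (q n) (n + 1) n := by
  obtain ⟨hdn, -⟩ := recurrence_natDegree_le_coeff hq0 hq1 hrec n
  obtain ⟨hdn1, hcn1⟩ := recurrence_natDegree_le_coeff hq0 hq1 hrec (n + 1)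
  have h1 : q (n + 2) = C (-b (n + 1)) * q n + q (n + 1) * (Polynomial.X - C (a (n + 1))) := by rw [hrec n, map_neg]; ring
  have hdeg : (C (-b (n + 1)) * q n).natDegree ≤ n := (natDegree_C_mul_le _ _).trans hdn
  rw [h1, resultant_add_mul_left _ _ _ _ _ (by have := natDegree_X_sub_C_le (a (n + 1)); omega) hdn1,
    resultant_add_left_deg _ _ n (n + 1) 2 hdeg, hcn1, one_pow, mul_one, resultant_C_mul_left, resultant_comm _ _ n (n + 1),
    Even.neg_one_pow (by rw [Nat.even_mul]; exact Or.inr (by decide)), Even.neg_one_pow (Nat.even_mul_succ_self n), one_mul, one_mul]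

/-- **SCHUR'S THEOREM: `Res_{(n+1,n)}(q_{n+1}, q_n) = ∏_{k<n} (−b_{k+1})^{k+1}`** over any commutative ring. [Schur 1931 §1; Szegő (6.71.2); Ismail Lemma 3.4.1; this file, §1168] -/
theorem schur_resultant {R : Type*} [CommRing R] {q : ℕ → R[X]} {a b : ℕ → R} (hq0 : q 0 = 1) (hq1 : q 1 = Polynomial.X - C (a 0))
    (hrec : ∀ n, q (n + 2) = (Polynomial.X - C (a (n + 1))) * q (n + 1) - C (b (n + 1)) * q n) (n : ℕ) :
    (q (n + 1)).resultant (q n) (n + 1) n = ∏ k ∈ Finset.range n, (-b (k + 1)) ^ (k + 1) := by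
  induction n with
  | zero => rw [Finset.prod_range_zero, hq0, resultant_one_right, pow_zero]
  | succ n ih => rw [show n + 1 + 1 = n + 2 from rfl, schur_resultant_succ hq0 hq1 hrec n, ih, Finset.prod_range_succ, mul_comm]

/-- `∏_{k<n} (−b_{k+1})^{k+1} = (−1)^{n(n+1)∕2} ∏_{k<n} b_{k+1}^{k+1}` (the exponents add up to `n(n+1)∕2`). [this file, §1168] -/
theorem prod_neg_pow_succ_eq {R : Type*} [CommRing R] (b : ℕ → R) (n : ℕ) :
    ∏ k ∈ Finset.range n, (-b (k + 1)) ^ (k + 1) = (-1) ^ (n * (n + 1) / 2) * ∏ k ∈ Finset.range n, b (k + 1) ^ (k + 1) := by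
  induction n with
  | zero => simp
  | succ n ih =>
    have h2 : (n + 1) * (n + 1 + 1) = n * (n + 1) + 2 * (n + 1) := by ring
    rw [Finset.prod_range_succ, Finset.prod_range_succ, ih, neg_pow, show (n + 1) * (n + 1 + 1) / 2 = n * (n + 1) / 2 + (n + 1) by
      obtain ⟨c, hc⟩ := Nat.even_mul_succ_self n; omega, pow_add]
    ring

/-- **SCHUR'S THEOREM, SIGN FORM: `Res_{(n+1,n)}(q_{n+1}, q_n) = (−1)^{n(n+1)∕2} ∏_{k<n} b_{k+1}^{k+1}`.** [Schur 1931 §1; Szegő (6.71.2); this file, §1168] -/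
theorem schur_resultant_sign {R : Type*} [CommRing R] {q : ℕ → R[X]} {a b : ℕ → R} (hq0 : q 0 = 1) (hq1 : q 1 = Polynomial.X - C (a 0))
    (hrec : ∀ n, q (n + 2) = (Polynomial.X - C (a (n + 1))) * q (n + 1) - C (b (n + 1)) * q n) (n : ℕ) :
    (q (n + 1)).resultant (q n) (n + 1) n = (-1) ^ (n * (n + 1) / 2) * ∏ k ∈ Finset.range n, b (k + 1) ^ (k + 1) := by
  rw [schur_resultant hq0 hq1 hrec, prod_neg_pow_succ_eq]

/-- The swapped resultant has the same value: `Res_{(n,n+1)}(q_n, q_{n+1}) = ∏_{k<n} (−b_{k+1})^{k+1}` (the sign `(−1)^{n(n+1)}` is `+1`). [this file, §1168] -/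
theorem schur_resultant_swap {R : Type*} [CommRing R] {q : ℕ → R[X]} {a b : ℕ → R} (hq0 : q 0 = 1) (hq1 : q 1 = Polynomial.X - C (a 0))
    (hrec : ∀ n, q (n + 2) = (Polynomial.X - C (a (n + 1))) * q (n + 1) - C (b (n + 1)) * q n) (n : ℕ) :
    (q n).resultant (q (n + 1)) n (n + 1) = ∏ k ∈ Finset.range n, (-b (k + 1)) ^ (k + 1) := by
  rw [resultant_comm, Even.neg_one_pow (Nat.even_mul_succ_self n), one_mul, schur_resultant hq0 hq1 hrec]

/-- **SCHUR AT THE ZEROS: if `q_{t+1} = ∏_k (X − x_k)` (any field, any `x`), then `∏_k q_t(x_k) = (−1)^{t(t+1)∕2} ∏_{j<t} b_{j+1}^{j+1}`.** [Schur 1931 §1 («`∏ q_{n−1}(x_ν)`»); Szegő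
(6.71.2); this file, §1168] -/
theorem prod_eval_pred_at_zeros {K : Type*} [Field K] {q : ℕ → K[X]} {a b : ℕ → K} (hq0 : q 0 = 1) (hq1 : q 1 = Polynomial.X - C (a 0))
    (hrec : ∀ n, q (n + 2) = (Polynomial.X - C (a (n + 1))) * q (n + 1) - C (b (n + 1)) * q n) {t : ℕ} {x : Fin (t + 1) → K}
    (hxq : q (t + 1) = ∏ k, (Polynomial.X - C (x k))) :
    ∏ k, (q t).eval (x k) = (-1) ^ (t * (t + 1) / 2) * ∏ j ∈ Finset.range t, b (j + 1) ^ (j + 1) := by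
  obtain ⟨hdt, -⟩ := recurrence_natDegree_le_coeff hq0 hq1 hrec t
  have h := schur_resultant_sign hq0 hq1 hrec t
  rw [hxq] at h
  rw [← h]
  have hlc : ∏ i ∈ (Finset.univ : Finset (Fin (t + 1))), (Polynomial.X - C (x i)).leadingCoeff ≠ 0 := by
    rw [Finset.prod_eq_one fun i _ => leadingCoeff_X_sub_C (x i)]; exact one_ne_zero
  have key := resultant_prod_left Finset.univ (fun k => Polynomial.X - C (x k)) (q t) t hlc hdt
  rw [natDegree_finsetProd_X_sub_C_eq_card, Finset.card_univ, Fintype.card_fin] at key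
  rw [key]
  exact Finset.prod_congr rfl fun k _ => by rw [natDegree_X_sub_C, resultant_X_sub_C_left _ _ _ hdt]

/-- At the zeros of `q_{t+1}`: **`∏_k q_{t+2}(x_k) = (−b_{t+1})^{t+1} ∏_k q_t(x_k)`** (termwise `q_{t+2}(x_k) = −b_{t+1} q_t(x_k)`). [Schur 1931 §1; this file, §1168] -/
theorem prod_eval_succ_at_zeros {K : Type*} [Field K] {q : ℕ → K[X]} {a b : ℕ → K}
    (hrec : ∀ n, q (n + 2) = (Polynomial.X - C (a (n + 1))) * q (n + 1) - C (b (n + 1)) * q n) {t : ℕ} {x : Fin (t + 1) → K}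
    (hxq : q (t + 1) = ∏ k, (Polynomial.X - C (x k))) :
    ∏ k, (q (t + 2)).eval (x k) = (-b (t + 1)) ^ (t + 1) * ∏ k, (q t).eval (x k) := by
  have hz : ∀ k, (q (t + 1)).eval (x k) = 0 := fun k => by
    rw [hxq, eval_prod]; exact Finset.prod_eq_zero (Finset.mem_univ k) (by simp)
  have hk : ∀ k, (q (t + 2)).eval (x k) = -b (t + 1) * (q t).eval (x k) := fun k => by
    rw [hrec t, eval_sub, eval_mul, hz k, mul_zero, zero_sub, eval_mul, eval_C, neg_mul]
  rw [Finset.prod_congr rfl fun k _ => hk k, Finset.prod_mul_distrib, Finset.prod_const, Finset.card_univ, Fintype.card_fin]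

end Summit.Ventures.HSemireg.Wedge.HankelOuter
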